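import Summits.AnomalousDissipation.AnomalousDissipation.Theorems.SolenoidalFractalHomogenisationLagrangianStepFrameModulation
import Literature.Analysis.FunctionSpaces.TorusPiola
import Literature.Analysis.FunctionSpaces.FlatTorusProofs
import HarnessLib

/-!
# K1L_D (stmt-AnomalousDissipation-27980), `stub_Z7_alphaBeta` α-provider: the CLOSED refresh window — frame facts up to and including
# the right endpoint `(j+1)·refresh (m+1)` (helper; `--supports … --as helper`; lead-k1l-onelevel-p1 g5; tenure menu L7 discharged Summits-side)

The window clauses of `LevelRegular` ((F1c): time-UNIFORM bounds on the `x`-derivatives of `disp m t (jR)`) are stated on the half-open window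
`t ∈ [jR, (j+1)R)`; every frame lemma of the line (`det ∇X = 1`, `(∇X)⁻¹ = adj ∇X`, Piola, smooth `frameG`) was therefore stated for
`u ∈ Icc 0 T` with `T < R` STRICT, while the glue's first piece is the CLOSED window `[jR, (j+1)R]` (memo L13; p3's endpoint caveat).
The gap is only apparent: at the single time `t = (j+1)R` the displacement is smooth ((F1b), all times), and the iterated derivatives of the
periodic lift of ONE smooth torus function are bounded (continuous and `ℤ³`-periodic, §1); so the clause package holds on `Icc 0 T` for every
`T ≤ R` (§2, `window_disp_clauses_closed`), and the generic window theorems of `Literature.Analysis.ODE.TorusFlow` apply verbatim on the closed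
window: **`det_frameJac_eq_one_closed`**, **`frameG_eq_adjugate_closed`**, **`isSmooth_frameG_entry_closed`**, **`isDivFree_frameG_col_closed`**
(Piola) for `u ∈ Icc 0 T`, `T ≤ refresh (m+1)` (§3).  NOT a proof of the stub, of the crux, or of AD; rung F-D1.A0.
-/

set_option linter.dupNamespace false  -- the summit-side namespace `Summit.AnomalousDissipation.AnomalousDissipation.…` repeats a component by design (D-0017)

noncomputable section

namespace Summit.AnomalousDissipation.AnomalousDissipation.Theorems.SolenoidalFractalHomogenisation.LagrangianStep.FrameConj

open Set Function Filter MeasureTheory Topology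
open Literature.Analysis Literature.Analysis.ODE Literature.Analysis.ODE.TorusFlow Literature.Analysis.FunctionSpaces
open Literature.Analysis.FunctionSpaces.Torus
open Literature.Analysis.FluidPDE Literature.Analysis.FluidPDE.LatticeShear
open Literature.Analysis.FluidPDE.LatticeShear (LagrangianLatticeCarrier)
open Summit.AnomalousDissipation.AnomalousDissipation.Theorems.SolenoidalFractalHomogenisation.LagrangianStep.FrameForm
  (frameJac_eq_of isSmooth_adjugate_frameJac_entry)

variable {k : ℕ}

/-! ## §1 Derivatives of the lift of ONE smooth torus function are bounded -/

section Periodic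

variable {d : Type*} [Fintype d] [DecidableEq d] {F : Type*} [NormedAddCommGroup F] [NormedSpace ℝ F]

/-- The iterated derivatives of the periodic lift of a torus function are `ℤ^d`-periodic (`iteratedFDeriv_comp_add_right`). -/
theorem isLatticePeriodic_iteratedFDeriv_lift_gen (f : UnitAddTorus d → F) (n : ℕ) :
    Torus.IsLatticePeriodic (iteratedFDeriv ℝ n (lift f)) := by
  intro j x
  have hper : (fun y => lift f (y + EuclideanSpace.single j 1)) = lift f := funext fun y => isLatticePeriodic_lift f j y
  rw [← iteratedFDeriv_comp_add_right n (EuclideanSpace.single j 1) x, hper]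

omit [NormedSpace ℝ F] in
/-- A continuous `ℤ^d`-periodic function is bounded (it factors through the compact torus). -/
theorem exists_norm_le_of_isLatticePeriodic {g : EuclideanSpace ℝ d → F} (hg : Torus.IsLatticePeriodic g) (hc : Continuous g) :
    ∃ C : ℝ, ∀ y, ‖g y‖ ≤ C := by
  have hl : lift (descend g hg) = g := lift_descend_holds g hg
  have hc' : Continuous (descend g hg) := by
    rw [← continuous_lift_iff, hl]; exact hc
  obtain ⟨C, hC⟩ := isCompact_univ.exists_bound_of_continuousOn hc'.continuousOn
  refine ⟨C, fun y => ?_⟩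
  have h : g y = descend g hg (proj y) := by rw [← lift_apply (descend g hg) y, hl]
  rw [h]
  exact hC _ (mem_univ _)

/-- **The iterated derivatives of the lift of a smooth torus function are bounded** — the single-time form of the window clause (F1c). -/
theorem exists_norm_iteratedFDeriv_lift_le {f : UnitAddTorus d → F} (hf : IsSmooth f) (n : ℕ) :
    ∃ C : ℝ, ∀ y, ‖iteratedFDeriv ℝ n (lift f) y‖ ≤ C :=
  exists_norm_le_of_isLatticePeriodic (isLatticePeriodic_iteratedFDeriv_lift_gen f n)
    (hf.continuous_iteratedFDeriv (by exact_mod_cast le_top))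

end Periodic

/-! ## §2 The displacement clauses on the CLOSED window -/

/-- Continuity of a space–time lift from joint continuity. -/
theorem continuousOn_stLift_of_continuous' {u : ℝ → UnitAddTorus (Fin 3) → EuclideanSpace ℝ (Fin 3)}
    (hu : Continuous fun p : ℝ × UnitAddTorus (Fin 3) => u p.1 p.2) (S : Set (ℝ × EuclideanSpace ℝ (Fin 3))) :
    ContinuousOn (stLift u) S := by
  have h : Continuous (stLift u) := hu.comp (continuous_fst.prodMk (continuous_proj.comp continuous_snd))
  exact h.continuousOn

/-- **(F1) on the CLOSED window**: for `T ≤ refresh (m+1)` the displacement `s ↦ disp m (jR + s) (jR)` has continuous space–time lift on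
`[0,T] × ℝ³`, smooth slices, and time-UNIFORM bounds on all `x`-derivatives on `[0,T]` — the half-open clause (F1c) plus the single time `s = R`. -/
theorem window_disp_clauses_closed (E : LagrangianLatticeCarrier k) (hR : E.LevelRegular) (m : ℕ) (j : ℤ) {T : ℝ}
    (hT : T ≤ E.refresh (m + 1)) :
    ContinuousOn (stLift fun s => E.disp m ((j : ℝ) * E.refresh (m + 1) + s) ((j : ℝ) * E.refresh (m + 1))) (Icc 0 T ×ˢ univ) ∧
      (∀ t ∈ Icc 0 T, IsSmooth (E.disp m ((j : ℝ) * E.refresh (m + 1) + t) ((j : ℝ) * E.refresh (m + 1)))) ∧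
      ∀ n : ℕ, ∃ C : ℝ, ∀ t ∈ Icc 0 T, ∀ y,
        ‖iteratedFDeriv ℝ n (lift (E.disp m ((j : ℝ) * E.refresh (m + 1) + t) ((j : ℝ) * E.refresh (m + 1)))) y‖ ≤ C := by
  refine ⟨?_, fun t _ => hR.isSmooth_disp m _ _, fun n => ?_⟩
  · refine continuousOn_stLift_of_continuous' ?_ _
    exact (hR.continuous_disp m ((j : ℝ) * E.refresh (m + 1))).comp ((continuous_const.add continuous_fst).prodMk continuous_snd)
  · obtain ⟨C, hC⟩ := hR.exists_norm_iteratedFDeriv_disp_le m n j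
    obtain ⟨C', hC'⟩ := exists_norm_iteratedFDeriv_lift_le
      (hR.isSmooth_disp m ((j : ℝ) * E.refresh (m + 1) + E.refresh (m + 1)) ((j : ℝ) * E.refresh (m + 1))) n
    refine ⟨max C C', fun t ht y => ?_⟩
    rcases lt_or_eq_of_le (ht.2.trans hT) with hlt | heq
    · refine (hC ((j : ℝ) * E.refresh (m + 1) + t) ⟨by linarith [ht.1], ?_⟩ y).trans (le_max_left _ _)
      have e : ((j : ℝ) + 1) * E.refresh (m + 1) = (j : ℝ) * E.refresh (m + 1) + E.refresh (m + 1) := by ring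
      rw [e]; linarith
    · rw [heq]; exact (hC' y).trans (le_max_right _ _)

/-! ## §3 Frame facts on the closed window -/

/-- **`det ∇X = 1` on the CLOSED window** (Liouville; `TorusFlow.det_flowJac_eq_one` with the closed clauses). -/
theorem det_flowDeriv_eq_one_closed (E : LagrangianLatticeCarrier k) (hR : E.LevelRegular) {m : ℕ} (hF : E.IsFlow m) (j : ℤ)
    {T : ℝ} (hT : T ≤ E.refresh (m + 1)) {s : ℝ} (hs : s ∈ Icc 0 T) (y : UnitAddTorus (Fin 3)) :
    (Matrix.of fun a c => (E.flowDeriv m ((j : ℝ) * E.refresh (m + 1) + s) ((j : ℝ) * E.refresh (m + 1)) y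
      (EuclideanSpace.single c (1 : ℝ))) a).det = 1 := by
  obtain ⟨hbc, hbs, hbB, hdiv⟩ := hR.window_b_clauses m ((j : ℝ) * E.refresh (m + 1)) T
  obtain ⟨hDc, hDs, hDB⟩ := window_disp_clauses_closed E hR m j hT
  simp_rw [hR.flowDeriv_single_apply]
  exact det_flowJac_eq_one hbc hbs hbB hDc hDs hDB (fun s _ x => hF.window_integral_eq _ s x) hdiv hs y

/-- `det (frameJac) = 1` on the closed window. -/
theorem det_frameJac_eq_one_closed (E : LagrangianLatticeCarrier k) (hR : E.LevelRegular) {m : ℕ} (hF : E.IsFlow m) (j : ℤ)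
    {T : ℝ} (hT : T ≤ E.refresh (m + 1)) {u : ℝ} (hu : u ∈ Icc 0 T) (y : UnitAddTorus (Fin 3)) :
    (frameJac E m ((j : ℝ) * E.refresh (m + 1) + u) ((j : ℝ) * E.refresh (m + 1)) y).det = 1 := by
  rw [frameJac_eq_of]
  exact det_flowDeriv_eq_one_closed E hR hF j hT hu y

/-- `det (frameG) = 1` on the closed window. -/
theorem det_frameG_eq_one_closed (E : LagrangianLatticeCarrier k) (hR : E.LevelRegular) {m : ℕ} (hF : E.IsFlow m) (j : ℤ)
    {T : ℝ} (hT : T ≤ E.refresh (m + 1)) {u : ℝ} (hu : u ∈ Icc 0 T) (y : UnitAddTorus (Fin 3)) :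
    (frameG E m ((j : ℝ) * E.refresh (m + 1) + u) ((j : ℝ) * E.refresh (m + 1)) y).det = 1 := by
  rw [frameG, Matrix.det_nonsing_inv, det_frameJac_eq_one_closed E hR hF j hT hu y, Ring.inverse_one]

/-- **`frameG = adj (frameJac)` on the closed window.** -/
theorem frameG_eq_adjugate_closed (E : LagrangianLatticeCarrier k) (hR : E.LevelRegular) {m : ℕ} (hF : E.IsFlow m) (j : ℤ)
    {T : ℝ} (hT : T ≤ E.refresh (m + 1)) {u : ℝ} (hu : u ∈ Icc 0 T) (y : UnitAddTorus (Fin 3)) :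
    frameG E m ((j : ℝ) * E.refresh (m + 1) + u) ((j : ℝ) * E.refresh (m + 1)) y =
      (frameJac E m ((j : ℝ) * E.refresh (m + 1) + u) ((j : ℝ) * E.refresh (m + 1)) y).adjugate := by
  rw [frameG, Matrix.inv_def, det_frameJac_eq_one_closed E hR hF j hT hu y, Ring.inverse_one, one_smul]

/-- Every entry of `frameG` is smooth in the label on the closed window. -/
theorem isSmooth_frameG_entry_closed (E : LagrangianLatticeCarrier k) (hR : E.LevelRegular) {m : ℕ} (hF : E.IsFlow m) (j : ℤ)
    {T : ℝ} (hT : T ≤ E.refresh (m + 1)) {u : ℝ} (hu : u ∈ Icc 0 T) (i l : Fin 3) :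
    IsSmooth (fun y => frameG E m ((j : ℝ) * E.refresh (m + 1) + u) ((j : ℝ) * E.refresh (m + 1)) y i l) := by
  have e : (fun y => frameG E m ((j : ℝ) * E.refresh (m + 1) + u) ((j : ℝ) * E.refresh (m + 1)) y i l) =
      fun y => (frameJac E m ((j : ℝ) * E.refresh (m + 1) + u) ((j : ℝ) * E.refresh (m + 1)) y).adjugate i l := by
    funext y; rw [frameG_eq_adjugate_closed E hR hF j hT hu y]
  rw [e]
  exact isSmooth_adjugate_frameJac_entry E hR j u i l

/-- **Piola on the closed window**: the columns of `frameG = adj ∇X` are divergence free (`Torus.isDivFree_adjugate_col`). -/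
theorem isDivFree_frameG_col_closed (E : LagrangianLatticeCarrier k) (hR : E.LevelRegular) {m : ℕ} (hF : E.IsFlow m) (j : ℤ)
    {T : ℝ} (hT : T ≤ E.refresh (m + 1)) {u : ℝ} (hu : u ∈ Icc 0 T) (i : Fin 3) :
    IsDivFree (fun y => (WithLp.toLp 2 fun c =>
      frameG E m ((j : ℝ) * E.refresh (m + 1) + u) ((j : ℝ) * E.refresh (m + 1)) y c i : EuclideanSpace ℝ (Fin 3))) := by
  have hD : IsSmooth (E.disp m ((j : ℝ) * E.refresh (m + 1) + u) ((j : ℝ) * E.refresh (m + 1))) := hR.isSmooth_disp m _ _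
  have h := isDivFree_adjugate_col hD i
  have e : (fun y => (WithLp.toLp 2 fun c =>
      frameG E m ((j : ℝ) * E.refresh (m + 1) + u) ((j : ℝ) * E.refresh (m + 1)) y c i : EuclideanSpace ℝ (Fin 3))) =
      fun y => WithLp.toLp 2 fun c => (Matrix.of fun a c' => (1 : Matrix (Fin 3) (Fin 3) ℝ) a c' +
        partialDeriv c' (fun w => E.disp m ((j : ℝ) * E.refresh (m + 1) + u) ((j : ℝ) * E.refresh (m + 1)) w a) y).adjugate c i := by
    funext y
    rw [frameG_eq_adjugate_closed E hR hF j hT hu y]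
    congr 2
    funext c
    congr 2
    ext a c'
    rw [frameJac, Matrix.of_apply, Matrix.of_apply, hR.flowDeriv_single_apply]
  rw [e]
  exact h

/-- The pointwise Piola identity in the index form consumed by `FrameForm.viscAdjVar_conj_comp_displacement` (`hPiola`):
`Σ_e ∂_e G_{eb} = 0` on the closed window. -/
theorem sum_partialDeriv_frameG_eq_zero_closed (E : LagrangianLatticeCarrier k) (hR : E.LevelRegular) {m : ℕ} (hF : E.IsFlow m)
    (j : ℤ) {T : ℝ} (hT : T ≤ E.refresh (m + 1)) {u : ℝ} (hu : u ∈ Icc 0 T) (b : Fin 3) (y : UnitAddTorus (Fin 3)) :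
    ∑ e, partialDeriv e (fun y' => frameG E m ((j : ℝ) * E.refresh (m + 1) + u) ((j : ℝ) * E.refresh (m + 1)) y' e b) y = 0 := by
  have h := isDivFree_frameG_col_closed E hR hF j hT hu b y
  rw [divergence] at h
  simpa only [PiLp.toLp_apply] using h

end Summit.AnomalousDissipation.AnomalousDissipation.Theorems.SolenoidalFractalHomogenisation.LagrangianStep.FrameConj

end
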